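import Summits.QuantumFields.QCD.Theorems.RobustYangMillsHandover.Negative.SchemeAsymptotics
import Summits.QuantumFields.QCD.Theorems.RobustYangMillsHandover.Negative.FreeWilsonModes
import Literature.MathematicalPhysics.QuantumLattice.WilsonPropagatorHeavyMass
import Literature.Barriers.QuantumFields.WilsonDeterminantMassSplitting

/-!
# `RobustYangMillsHandover` — the hopping window of the handed-over trajectory (negative lane, cycle 3)

Crux `stmt-QuantumFields-8892` (route `HeatSlicedQuarks`), cdisprove seat, cycle 3 (2026-08-16);
companion of `Cruxes/RobustYangMillsHandover/Disproof.lean` §12.  Everything here is about objects of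
the QCD statement (`QCDRegularisation.scheme`, the tree's `wilsonDirac`) and of two catalogued
barriers; nothing asserts a Theses declaration.

**A. The window.**  Along the bare trajectory `m_f(k) = m_crit(k) + a_k m_f / Z_m(k)` handed over by
X₀, with the witness's critical mass one loop deep (`m_crit(k) ≤ −c/log(1/a_k²)`, Montvay–Münster
(5.62)) and the physical-branch clause `m_f(k) > −1` of `IsQCDAlong`, the Wilson hopping parameter
`κ_f(k) = 1/(2 m_f(k) + 8)` lies eventually in the window `1/8 < κ_f(k) < 1/6`
(`scheme_hoppingParam_window`): INSIDE Lüscher's transfer-matrix positivity range `κ < 1/6`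
(Montvay–Münster (4.111)), OUTSIDE Seiler's determinant-positivity / uniform hopping-convergence
disc `κ < 1/8` (Rothe 2005 p. 163; catalogued `Literature.Barriers.QuantumFields.HoppingExpansionLocality`,
tree `WilsonPropagatorHeavyMass`).

**B. Tightness at the trivial gauge field.**  The tree's heavy-mass Neumann bound
`‖1 − (m+4)⁻¹ D_W(U, m, 1)‖ ≤ 4/(m+4)` (`norm_one_sub_smul_wilsonDirac_le`, HJL (2.14)) is ATTAINED at
`U ≡ 1` on the site-constant colour–spin modes (`one_sub_smul_wilsonDirac_one_mulVec_const`,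
`le_norm_one_sub_smul_wilsonDirac_one`), so the hopping ratio is `≥ 1` exactly when `m ≤ 0`
(`one_le_hoppingRatio_iff`): at the scheme's eventually NEGATIVE bare masses the hopping-parameter
series `Σ_l (1 − (m+4)⁻¹D_W)^l` applied to a constant mode has terms of norm `(4/(m+4))^l ↛ 0`
(`hoppingSeries_term_not_tendsto_zero`), i.e. Montvay–Münster (5.36) diverges on the smoothest
background.  "A convergent heavy-hopping / polymer expansion" (the crux's informal mechanism, source
MM §5.1.3 "where legitimate") is therefore NOT legitimate for the fine-lattice operator at the
scheme's own bare mass: it can only concern a blocked operator below the quark scale.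

**C. Barrier transfer (sign of the weight).**  Bare masses are ordered like the renormalised ones and
their splitting is `a_k (m_g − m_f)/Z_m(k) → 0` (`scheme_mq_sub`, `scheme_mq_lt_of_lt`,
`tendsto_scheme_mq_sub`).  By the catalogued `WilsonDeterminantMassSplitting` (filed for the
ChiralRegime sub-problem) a negative two-flavour Wilson weight `det D_W(m_f(k)) det D_W(m_g(k))` at
step `k` forces an exact real mode of `D_W(U, ·, 1)` inside that shrinking bare-mass interval
(`splitWeight_neg_imp_zeroMode_between`); with A this barrier and `WilsonDeterminantSign`
(`sign det = (−1)^{n₋}`) apply verbatim to the MASSIVE conjunct: for every non-degenerate tuple (all of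
which `∀ m` demands) the lattice gap clause `HasLatticeMassGap` of the conclusion `QCD` is a clustering
statement about the SIGNED functional `qcdTorusExpect`, in all volumes `S ≥ L_k` at fixed cutoff.
-/

noncomputable section

namespace Summit.QuantumFields.QCD.Theorems.RobustYangMillsHandover.Negative

open Literature.MathematicalPhysics.QuantumLattice Literature.MathematicalPhysics.QuantumFieldTheory
open Literature.Probability.LatticeModels Matrix Finset Filter Topology
open scoped Matrix.Norms.L2Operator

/-! ### A. The hopping-parameter window `1/8 < κ < 1/6` -/

/-- `κ = 1/(2m+8) > 1/8 ↔ m < 0` (for `2m + 8 > 0`). [folklore] -/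
theorem hoppingParam_gt_eighth_iff {m : ℝ} (h : 0 < 2 * m + 8) :
    (1 : ℝ) / 8 < 1 / (2 * m + 8) ↔ m < 0 := by
  rw [one_div_lt_one_div (by norm_num) h]
  constructor <;> intro h' <;> linarith

/-- `κ = 1/(2m+8) < 1/6 ↔ −1 < m` (for `2m + 8 > 0`): Lüscher's positivity range. [folklore] -/
theorem hoppingParam_lt_sixth_iff {m : ℝ} (h : 0 < 2 * m + 8) :
    1 / (2 * m + 8) < (1 : ℝ) / 6 ↔ -1 < m := by
  rw [one_div_lt_one_div h (by norm_num)]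
  constructor <;> intro h' <;> linarith

/-- **The hopping window of the handed-over trajectory.** Under `HasMassScaling`, a one-loop-deep
critical mass `m_crit(k) ≤ −c/log(1/a_k²)` (eventually) and the physical-branch clause
`m_f(k) > −1` (eventually; part of `IsQCDAlong`), the hopping parameter `κ_f(k) = 1/(2m_f(k)+8)` of
every flavour satisfies `1/8 < κ_f(k) < 1/6` for all large `k`. [cite: MontvayMunster1994, §5.1.6 (5.62) and §4.2.3 (4.111)] -/
theorem scheme_hoppingParam_window {Nf : ℕ} (hNf : Nf ≤ 16) (reg : QCDRegularisation Nf)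
    (hms : reg.HasMassScaling) {c : ℝ} (hc : 0 < c)
    (hcrit : ∀ᶠ k in atTop, reg.mcrit k ≤ -(c / Real.log (1 / reg.a k ^ 2)))
    (m : Fin Nf → ℝ) (z shift : QCDField Nf → ℕ → ℝ) (f : Fin Nf)
    (hbranch : ∀ᶠ k in atTop, -1 < (reg.scheme m z shift).mq f k) :
    ∀ᶠ k in atTop, (1 : ℝ) / 8 < 1 / (2 * (reg.scheme m z shift).mq f k + 8) ∧
      1 / (2 * (reg.scheme m z shift).mq f k + 8) < (1 : ℝ) / 6 := by
  filter_upwards [scheme_mq_eventually_neg_of_logBound hNf reg hms hc hcrit m z shift f, hbranch]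
    with k hneg hgt
  have h8 : 0 < 2 * (reg.scheme m z shift).mq f k + 8 := by linarith
  exact ⟨(hoppingParam_gt_eighth_iff h8).2 hneg, (hoppingParam_lt_sixth_iff h8).2 hgt⟩

/-! ### B. Tightness of the heavy-mass Neumann bound at `U ≡ 1` -/

/-- `1 ≤ 4/(m+4) ↔ m ≤ 0` (for `m + 4 > 0`). [folklore] -/
theorem one_le_hoppingRatio_iff {m : ℝ} (h : 0 < m + 4) : 1 ≤ 4 / (m + 4) ↔ m ≤ 0 := by
  rw [le_div_iff₀ h]
  constructor <;> intro h' <;> linarith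

/-- `1 < 4/(m+4) ↔ m < 0` (for `m + 4 > 0`). [folklore] -/
theorem one_lt_hoppingRatio_iff {m : ℝ} (h : 0 < m + 4) : 1 < 4 / (m + 4) ↔ m < 0 := by
  rw [lt_div_iff₀ h]
  constructor <;> intro h' <;> linarith

section TrivialField

variable {L N : ℕ} [NeZero L] {G : Type*} [Group G] (ρ : G →* Matrix (Fin N) (Fin N) ℂ)

/-- **The hopping operator on constant modes.** At `U ≡ 1` the hopping part
`1 − (m+4)⁻¹ D_W(1, m, 1)` multiplies every site-constant colour–spin vector by `4/(m+4)` (the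
`p = 0` corner: `D_W(1,m,1) v = m v`, landed `wilsonDirac_one_mulVec_const_eq_smul`). [folklore] -/
theorem one_sub_smul_wilsonDirac_one_mulVec_const (m : ℝ) (hm : m + 4 ≠ 0) (w : Fin N × Fin 4 → ℂ) :
    ((1 : Matrix _ _ ℂ) - ((m + 4 : ℝ) : ℂ)⁻¹ • wilsonDirac ρ (1 : GaugeConfig 4 L G) m 1) *ᵥ
        (fun q => w q.2) = ((4 / (m + 4) : ℝ) : ℂ) • fun q => w q.2 := by
  rw [Matrix.sub_mulVec, Matrix.smul_mulVec, Matrix.one_mulVec,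
    wilsonDirac_one_mulVec_const_eq_smul ρ m 1 w, smul_smul]
  have hm' : ((m + 4 : ℝ) : ℂ) ≠ 0 := by exact_mod_cast hm
  have : (1 : ℂ) - ((m + 4 : ℝ) : ℂ)⁻¹ * (m : ℂ) = ((4 / (m + 4) : ℝ) : ℂ) := by
    push_cast at hm' ⊢
    field_simp
    ring
  rw [← this, sub_smul, one_smul]

/-- Powers: the `l`-th hopping term on a constant mode is `(4/(m+4))^l` times the mode. [folklore] -/
theorem one_sub_smul_wilsonDirac_one_pow_mulVec_const (m : ℝ) (hm : m + 4 ≠ 0)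
    (w : Fin N × Fin 4 → ℂ) (l : ℕ) :
    (((1 : Matrix _ _ ℂ) - ((m + 4 : ℝ) : ℂ)⁻¹ • wilsonDirac ρ (1 : GaugeConfig 4 L G) m 1) ^ l) *ᵥ
        (fun q => w q.2) = (((4 / (m + 4)) ^ l : ℝ) : ℂ) • fun q => w q.2 := by
  induction l with
  | zero => simp
  | succ l ih =>
    rw [pow_succ, ← Matrix.mulVec_mulVec, one_sub_smul_wilsonDirac_one_mulVec_const ρ m hm w,
      Matrix.mulVec_smul, ih, smul_smul]
    push_cast
    ring_nf

/-- **The heavy-mass bound is attained at `U ≡ 1`.** For `m + 4 > 0` and `N ≥ 1`,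
`4/(m+4) ≤ ‖1 − (m+4)⁻¹ D_W(1, m, 1)‖` (ℓ² operator norm), so together with the landed
`norm_one_sub_smul_wilsonDirac_le` the norm EQUALS `4/(m+4)`; in particular it is `≥ 1` iff `m ≤ 0`
(`one_le_hoppingRatio_iff`) — the Neumann-series / hopping-expansion argument has no room beyond
`m > 0`, i.e. beyond `κ < 1/8`. [cite: HernandezJansenLuscher1999, (2.14)] -/
theorem le_norm_one_sub_smul_wilsonDirac_one [NeZero N] (m : ℝ) (hm : 0 < m + 4) :
    4 / (m + 4) ≤ ‖(1 : Matrix _ _ ℂ) - ((m + 4 : ℝ) : ℂ)⁻¹ • wilsonDirac ρ (1 : GaugeConfig 4 L G) m 1‖ := by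
  set A := (1 : Matrix _ _ ℂ) - ((m + 4 : ℝ) : ℂ)⁻¹ • wilsonDirac ρ (1 : GaugeConfig 4 L G) m 1 with hA
  -- the constant mode `v ≡ 1`
  set v : TorusSite 4 L × Fin N × Fin 4 → ℂ := fun q => (fun _ : Fin N × Fin 4 => (1 : ℂ)) q.2 with hv
  set x : EuclideanSpace ℂ (TorusSite 4 L × Fin N × Fin 4) := WithLp.toLp 2 v with hx
  have hAv : A *ᵥ v = ((4 / (m + 4) : ℝ) : ℂ) • v :=
    one_sub_smul_wilsonDirac_one_mulVec_const ρ m hm.ne' (fun _ => 1)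
  have hAx : ‖(WithLp.toLp 2 (A *ᵥ v) : EuclideanSpace ℂ _)‖ ≤ ‖A‖ * ‖x‖ :=
    Matrix.l2_opNorm_mulVec A x
  have hx0 : 0 < ‖x‖ := by
    refine norm_pos_iff.mpr ?_
    intro h0
    have : v ((0 : TorusSite 4 L), (0 : Fin N), (0 : Fin 4)) = 0 := by
      have := congrArg (fun y : EuclideanSpace ℂ (TorusSite 4 L × Fin N × Fin 4) => y (0, 0, 0)) h0
      simpa [hx] using this
    simp [hv] at this
  have hnorm : ‖(WithLp.toLp 2 (A *ᵥ v) : EuclideanSpace ℂ _)‖ = 4 / (m + 4) * ‖x‖ := by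
    rw [hAv, WithLp.toLp_smul, norm_smul, Complex.norm_real, Real.norm_eq_abs,
      abs_of_nonneg (by positivity)]
  rw [hnorm] at hAx
  exact le_of_mul_le_mul_right hAx hx0

/-- Hence the norm is exactly `4/(m+4)` at the trivial field. [cite: HernandezJansenLuscher1999, (2.14)] -/
theorem norm_one_sub_smul_wilsonDirac_one_eq [NeZero N] (hρ : ∀ g, ρ g ∈ Matrix.unitaryGroup (Fin N) ℂ)
    (m : ℝ) (hm : 0 < m + 4) :
    ‖(1 : Matrix _ _ ℂ) - ((m + 4 : ℝ) : ℂ)⁻¹ • wilsonDirac ρ (1 : GaugeConfig 4 L G) m 1‖ = 4 / (m + 4) :=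
  le_antisymm (norm_one_sub_smul_wilsonDirac_le ρ hρ 1 m hm) (le_norm_one_sub_smul_wilsonDirac_one ρ m hm)

/-- **No contraction at non-positive bare mass**: for `−4 < m ≤ 0` the hopping operator at the
trivial field has norm `≥ 1`. [folklore] -/
theorem one_le_norm_one_sub_smul_wilsonDirac_one [NeZero N] (m : ℝ) (hm : 0 < m + 4) (hm0 : m ≤ 0) :
    1 ≤ ‖(1 : Matrix _ _ ℂ) - ((m + 4 : ℝ) : ℂ)⁻¹ • wilsonDirac ρ (1 : GaugeConfig 4 L G) m 1‖ :=
  ((one_le_hoppingRatio_iff hm).2 hm0).trans (le_norm_one_sub_smul_wilsonDirac_one ρ m hm)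

/-- **The hopping series diverges on constant modes for `m ≤ 0`.** The `l`-th term of
`Σ_l (1 − (m+4)⁻¹ D_W(1,m,1))^l v` on a non-zero constant mode `v` has a coordinate of modulus
`(4/(m+4))^l ‖w(a,α)‖`, which does not tend to `0` when `−4 < m ≤ 0`: Montvay–Münster's
hopping-parameter expansion (5.36) diverges at `κ = 1/(2m+8) ≥ 1/8` already for `U ≡ 1`.
[cite: MontvayMunster1994, §5.1.3 (5.36)] -/
theorem hoppingSeries_term_not_tendsto_zero (m : ℝ) (hm : 0 < m + 4) (hm0 : m ≤ 0)
    (w : Fin N × Fin 4 → ℂ) (p : TorusSite 4 L × Fin N × Fin 4) (hw : w p.2 ≠ 0) :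
    ¬ Tendsto (fun l : ℕ =>
        ((((1 : Matrix _ _ ℂ) - ((m + 4 : ℝ) : ℂ)⁻¹ • wilsonDirac ρ (1 : GaugeConfig 4 L G) m 1) ^ l) *ᵥ
          (fun q => w q.2)) p) atTop (𝓝 0) := by
  intro h
  have hq : 1 ≤ 4 / (m + 4) := (one_le_hoppingRatio_iff hm).2 hm0
  have hterm : ∀ l : ℕ, ‖w p.2‖ ≤
      ‖((((1 : Matrix _ _ ℂ) - ((m + 4 : ℝ) : ℂ)⁻¹ • wilsonDirac ρ (1 : GaugeConfig 4 L G) m 1) ^ l) *ᵥ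
          (fun q => w q.2)) p‖ := by
    intro l
    rw [one_sub_smul_wilsonDirac_one_pow_mulVec_const ρ m hm.ne' w l, Pi.smul_apply, norm_smul,
      Complex.norm_real, Real.norm_eq_abs, abs_of_nonneg (by positivity)]
    have : (1 : ℝ) ≤ (4 / (m + 4)) ^ l := one_le_pow₀ hq
    nlinarith [norm_nonneg (w p.2)]
  have h0 : Tendsto (fun l : ℕ => ‖((((1 : Matrix _ _ ℂ) - ((m + 4 : ℝ) : ℂ)⁻¹ •
      wilsonDirac ρ (1 : GaugeConfig 4 L G) m 1) ^ l) *ᵥ (fun q => w q.2)) p‖) atTop (𝓝 0) := by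
    simpa using h.norm
  have := ge_of_tendsto' h0 (fun l => hterm l)
  exact hw (norm_le_zero_iff.mp this)

end TrivialField

/-! ### C. Mass splitting along the trajectory and the sign of the two-flavour weight -/

/-- The bare-mass splitting of the scheme at step `k` is `a_k (m_g − m_f) / Z_m(k)`. [folklore] -/
theorem scheme_mq_sub {Nf : ℕ} (reg : QCDRegularisation Nf) (m : Fin Nf → ℝ)
    (z shift : QCDField Nf → ℕ → ℝ) (f g : Fin Nf) (k : ℕ) :
    (reg.scheme m z shift).mq g k - (reg.scheme m z shift).mq f k = reg.a k * (m g - m f) / reg.Zm k := by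
  simp only [QCDRegularisation.scheme_mq]
  ring

/-- Bare masses are ordered like the renormalised masses, at EVERY step. [folklore] -/
theorem scheme_mq_lt_of_lt {Nf : ℕ} (reg : QCDRegularisation Nf) (m : Fin Nf → ℝ)
    (z shift : QCDField Nf → ℕ → ℝ) {f g : Fin Nf} (hfg : m f < m g) (k : ℕ) :
    (reg.scheme m z shift).mq f k < (reg.scheme m z shift).mq g k := by
  have h := scheme_mq_sub reg m z shift f g k
  have hpos : 0 < reg.a k * (m g - m f) / reg.Zm k :=
    div_pos (mul_pos (reg.a_pos k) (by linarith)) (reg.Zm_pos k)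
  linarith

/-- … and the splitting tends to `0` in lattice units (`HasMassScaling`, `N_f ≤ 16`). [folklore] -/
theorem tendsto_scheme_mq_sub {Nf : ℕ} (hNf : Nf ≤ 16) (reg : QCDRegularisation Nf)
    (hms : reg.HasMassScaling) (m : Fin Nf → ℝ) (z shift : QCDField Nf → ℕ → ℝ) (f g : Fin Nf) :
    Tendsto (fun k => (reg.scheme m z shift).mq g k - (reg.scheme m z shift).mq f k) atTop (𝓝 0) := by
  simp_rw [scheme_mq_sub]
  exact tendsto_massIncrement_zero hNf reg hms (m g - m f)

/-- **Barrier transfer (`WilsonDeterminantMassSplitting`, filed for ChiralRegime, bites the massive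
trajectory).** If at step `k`, on some gauge field `U`, the two-flavour Wilson weight of flavours
`f, g` with `m_f < m_g` is negative, then `D_W(U, ·, 1)` has an exact zero mode at a bare mass
strictly between `m_f(k)` and `m_g(k)` — an interval of length `a_k (m_g − m_f)/Z_m(k) → 0`.
[cite: MohlerSchaefer2020, §2.2 and §5.3] -/
theorem splitWeight_neg_imp_zeroMode_between {Nf L N : ℕ} [NeZero L] {G : Type} [Group G]
    (ρ : G →* Matrix (Fin N) (Fin N) ℂ) (hρ : ∀ g, ρ g ∈ Matrix.unitaryGroup (Fin N) ℂ)
    (reg : QCDRegularisation Nf) (m : Fin Nf → ℝ) (z shift : QCDField Nf → ℕ → ℝ)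
    {f g : Fin Nf} (hfg : m f < m g) (k : ℕ) (U : GaugeConfig 4 L G)
    (hneg : ((wilsonDirac ρ U ((reg.scheme m z shift).mq f k) 1).det *
        (wilsonDirac ρ U ((reg.scheme m z shift).mq g k) 1).det).re < 0) :
    ∃ t ∈ Set.Ioo ((reg.scheme m z shift).mq f k) ((reg.scheme m z shift).mq g k),
      (wilsonDirac ρ U t 1).det = 0 :=
  (Literature.Barriers.QuantumFields.WilsonDeterminantMassSplitting_holds L N G ρ hρ U
      ((reg.scheme m z shift).mq f k) 1).2.1 _ (scheme_mq_lt_of_lt reg m z shift hfg k) hneg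

end Summit.QuantumFields.QCD.Theorems.RobustYangMillsHandover.Negative
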